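import Summits.QuantumFields.YangMills.Theorems.BalabanUVNodesK0Stub1DoubleBarFibreAtRecord
import Summits.QuantumFields.YangMills.Theorems.BalabanUVNodesK0Stub1DoubleBarFramesSU
import HarnessLib

/-!
# K0⁷ STUB 1 (`stub_prop8StepCoP13`), sub-target S4a — **THE ♭ → (0.4) FIBRE DICTIONARY AT THE K0 CARRIER, CLOSED**: the block-frame hypotheses of
# `…K0Stub1DoubleBarFibreAtRecord` DISCHARGED on the weighted ball (small-readable blocks := the `Ω_{j+1}`, frames in `SU(N)` by `…K0Stub1DoubleBarFramesSU`), leaving only the ball,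
# three k-uniform budgets, the charted `SU(N)` readings and the equal double-bar data — the curve-ready statement for the ♭-road socket (file 4 of this seat's g7 bricks)

Cell `pub-ymgap`, width seat `pub-ymgap-k0-s1-w1` g7 (CLAIM-2, second half — split for the 400-line cap).  `--kind proof --supports stmt-QuantumFields-20541 --as helper`; count-neutral.
[15] = [Balaban1985Variational]; [B7AVG] = [Balaban1985Averaging]; [B6] = [Balaban1984PropagatorsII]; [I] = [Balaban1987RG1]; [III] = [Balaban1988Convergent].

WHY.  `exists_suGauge_family_iter_eq` (companion file) displays an abstract `emb`-closed family `Sm ⊇ Ω` of small-readable blocks on which the block frames of the double-bar towers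
lie in `SU(N)`.  On the `IsLevWeight` ball `w₁(b)‖A(b)‖ < R` the natural instance is `Sm_{j} := Ω_j^{(j)}`: a fine bond under a block `z ∈ Ω_{j+1}^{(j+1)}` has territory level
`≥ j + 1` (`B11Eq115Space.le_levOf`), hence weight `≥ L^{j+1}·η` and `‖e^{iηA(b)} − 1‖ ≤ 2R·L^{−(j+1)}` (§4); file 3's `suN_vframeU_dbarIterU` at `s₀ = 2R·L^{−(j+1)}` turns the
B2 budget into `60800ℓ²R ≤ 1` and the (0.4) guard into `16ℓR < δ_N` (implied by the dictionary's `60ℓ²LR < δ_N`), k-UNIFORMLY; `emb`-closedness of `Ω` is [B6] (2.1) nesting.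

WHAT IS PROVED (sorry-free; no definition; axioms standard; generic `P : Params`, `N ≥ 1`).
* §4 `norm_expCfg_sub_one_le_of_mem_Om` · ★★ `suN_vframeU_dbarIterU_of_mem_Om` (`hvf` at `Sm := Ω` discharged); §4b `norm_dbarIterU_expCfg_sub_one_le_of_ball` (`‖U̿^{(j)}(e^{iηA})(c) − 1‖ ≤ 4LR`
  at the indices, `60800ℓ²LR ≤ 1`) · ★★ `dbarIterU_eq_of_chartLogFlat_eq_of_ball` (`hidx` from equal `Q♭` values on the ball — the (49)♭ competitors' currency).
* §5 ★★★★ `exists_suGauge_family_iter_eq_closed` (FAMILY form: uniform-choice clause + `Ū^{(j)}_{(0.4)}((U t)^{h t})(c) = Ū^{(j)}_{(0.4)}(U₁)(c)` at every (2.3) index bond of every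
  `j ≤ k`; displayed ONLY: `D.k = k`, collar, `IsLevWeight` ball, budgets `12800ℓ²LR ≤ 1`, `60800ℓ²R ≤ 1`, `60ℓ²LR < δ_N`, the charted `SU(N)` readings `U₁ = e^{iηA₁}`, `U t = e^{iηA t}`,
  equal double-bar data on `BondIdx D`, accumulated frames as any solutions of (97)) · ★★★★ `exists_suGauge_iter_eq_closed` (one competitor, frames hidden).
* §6 ★★★★ `exists_suGauge_family_avgFamily_eq_closed` — §5 at NODE 00's record objects (`F : T4Family`, `P = F.P K`): `avgFamily (avOfRecord F N K) ((U t)^{h t}) j c =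
  avgFamily (avOfRecord F N K) U₁ j c` — the letters of `Node00.IsCritOnFibre` ∕ `B15.AgreeOn`.
HONEST SCOPE.  Bookkeeping over the companion file, file 3, n07-w2 g3's dictionary; the ball, the budgets, the charted readings and the equal double-bar data are DISPLAYED and nothing
else; NO estimate of Bałaban's proved or asserted; NO derivative (differentiability of `t ↦ h t` and the criticality transfer are the next bricks); the SOCKET `h127rec` is NOT produced here;
`stub_prop8StepCoP13` ∕ K0⁷ NOT closed; N07 NOT discharged; counts unmoved (28∕28 · 5∕27); one finite 𝕋⁴ programme at fixed ε — R4 closes the conditional finite-𝕋⁴ rung `BalabanLadder.UV`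
only, never the summit; the YM mass gap (Clay) is NOT proved by any of this; nothing continuum ∕ ℝ⁴ ∕ OS.  No `sorry`, no `def`, no `instance`, no `notation`.

References: [B7AVG] T. Bałaban, CMP **98** (1985) 17–51 ((11) p.19, (92) p.31, (97)–(100) p.32, (110) p.34, Prop. 4 (134)–(135) p.38); [B6] CMP **96** (1984) 223–250 ((2.1)–(2.4) p.224);
[15] CMP **102** (1985) 277–309 ((5)–(6) p.278, (150)–(152) p.301, (156) p.302); [I] CMP **109** (1987) 249–301 ((0.4), (0.9), (0.11) p.253); [III] CMP **119** (1988) 243–285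
((2.10)–(2.12) p.256).
-/

set_option autoImplicit false

noncomputable section

namespace Summit.QuantumFields.YangMills.Theorems.K0Stub1DoubleBarFibreAtRecordClosed

open scoped BigOperators Matrix.Norms.L2Operator
open Literature.MathematicalPhysics.QuantumFieldTheory.Balaban1983to89
open T4Continuum BlockAveraging ExpMeanLog
open B10Eq27TorusAxialLog (gaugeActT gaugeActT_apply unitsField val_unitsField toUField suIncl val_suIncl)
open B5Eq118OneStroke (iterBlockOf)
open B15DeterminingSets (embIter avgFamily)
open B6SectADomainsV1 (Domains)
open B6SectAOperatorsV1 (BondIdx)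
open B11Eq115Space (levOf le_levOf)
open Node00 (avOfRecord)
open Summit.QuantumFields.YangMills.Theorems.Prop8Chart (expCfg emlIterU norm_coe_expCfg_sub_one_le)
open Summit.QuantumFields.YangMills.Theorems.Prop8ChartDoubleBar (vframeU dbarIterU exists_accFrames_dbarIterU chartLogFlat norm_dbarIterU_sub_one_le_two_mul₀)
open Summit.QuantumFields.YangMills.BalabanUVNodes.N07ChartRemainderP (norm_expCfg_sub_one_le_of_weightedBall)
open Summit.QuantumFields.YangMills.Theorems.K0FlatCubeOpsTextP (IsLevWeight)
open Summit.QuantumFields.YangMills.Theorems.K0Stub1DoubleBarFramesSU (suN_vframeU_dbarIterU)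
open Summit.QuantumFields.YangMills.Theorems.K0Stub1DoubleBarFibreAtRecord (exists_suGauge_family_iter_eq)

variable {P : Params} {N : ℕ}
/-! ## §4  The `SU(N)`-valuedness of the block frames DISCHARGED on the weighted ball (small-readable blocks := the `Ω_{j+1}`; file 3 `…K0Stub1DoubleBarFramesSU`) -/

section Discharge

variable [NeZero N] (k : ℕ) (D : Domains P) (hDk : D.k = k)

include hDk in
omit [NeZero N] in
/-- **NEAR-FLATNESS OF A CHARTED FIELD UNDER AN `Ω_{j+1}`-BLOCK**: on the weighted ball `w₁(b)‖A(b)‖ < R ≤ 1` (`w₁(b) = L^{lev(b₋)}·η`, `η = L^{−k}`), a fine bond `b` whose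
`(j+1)`-block lies in `Ω_{j+1}^{(j+1)}` (`j + 1 ≤ k`) has territory level `≥ j + 1`, so `‖e^{iηA(b)} − 1‖ ≤ 2·R·L^{−(j+1)}`.
[cite: Balaban1985Variational, (150) p.301, (152) p.301; Balaban1984PropagatorsII, (2.2) p.224] -/
theorem norm_expCfg_sub_one_le_of_mem_Om {w : ℕ → PBond P 0 → ℝ} (hw : IsLevWeight P k D w) {R : ℝ} (hR1 : R ≤ 1)
    {A : PBond P 0 → Matrix (Fin N) (Fin N) ℂ} (hA : ∀ b, w 1 b * ‖A b‖ < R) {j : ℕ} (hj : j + 1 ≤ D.k) {z : Site P (j + 1)} (hz : z ∈ D.Om (j + 1))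
    (b : PBond P 0) (hb : iterBlockOf (j + 1) b.src = z) :
    ‖((expCfg (((P.L : ℝ)⁻¹) ^ k) A b : (Matrix (Fin N) (Fin N) ℂ)ˣ) : Matrix (Fin N) (Fin N) ℂ) - 1‖ ≤ 2 * R * ((P.L : ℝ) ^ (j + 1))⁻¹ := by
  have hL1 : (1 : ℝ) ≤ P.L := by exact_mod_cast P.L_pos
  have hL0 : (0 : ℝ) < P.L := by linarith
  have hLj : 0 < (P.L : ℝ) ^ (j + 1) := by positivity
  set η : ℝ := ((P.L : ℝ)⁻¹) ^ k with hη
  have hη0 : 0 ≤ η := by positivity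
  -- the territory level of `b₋` is at least `j + 1`
  set lev := levOf (fun i => {y : Site P 0 | D.InOm i y}) D.k b.src with hlev
  have hin : b.src ∈ (fun i => {y : Site P 0 | D.InOm i y}) (j + 1) := by
    show D.InOm (j + 1) b.src
    unfold Domains.InOm; rw [hb]; exact hz
  have hlevj : j + 1 ≤ lev := le_levOf hj hin
  have hwb : w 1 b = (P.L : ℝ) ^ lev * η := by rw [hw 1 b, pow_one, hlev, hDk]
  have hwge : (P.L : ℝ) ^ (j + 1) * η ≤ w 1 b := by
    rw [hwb]; exact mul_le_mul_of_nonneg_right (pow_le_pow_right₀ hL1 hlevj) hη0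
  have hηA : η * ‖A b‖ ≤ R * ((P.L : ℝ) ^ (j + 1))⁻¹ := by
    rw [le_mul_inv_iff₀ hLj]
    calc η * ‖A b‖ * (P.L : ℝ) ^ (j + 1) = (P.L : ℝ) ^ (j + 1) * η * ‖A b‖ := by ring
      _ ≤ w 1 b * ‖A b‖ := mul_le_mul_of_nonneg_right hwge (norm_nonneg _)
      _ ≤ R := (hA b).le
  have hsmall : ‖((η : ℝ) : ℂ) • A b‖ ≤ 1 := by
    rw [norm_smul, Complex.norm_real, Real.norm_eq_abs, abs_of_nonneg hη0]
    refine hηA.trans ?_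
    calc R * ((P.L : ℝ) ^ (j + 1))⁻¹ ≤ 1 * ((P.L : ℝ) ^ (j + 1))⁻¹ := by gcongr
      _ ≤ 1 := by rw [one_mul]; exact inv_le_one_of_one_le₀ (one_le_pow₀ hL1)
  calc _ ≤ 2 * ‖((η : ℝ) : ℂ) • A b‖ := norm_coe_expCfg_sub_one_le η A b hsmall
    _ = 2 * (η * ‖A b‖) := by rw [norm_smul, Complex.norm_real, Real.norm_eq_abs, abs_of_nonneg hη0]
    _ ≤ 2 * (R * ((P.L : ℝ) ^ (j + 1))⁻¹) := by gcongr
    _ = 2 * R * ((P.L : ℝ) ^ (j + 1))⁻¹ := by ring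

include hDk in
/-- ★★ **`hvf` DISCHARGED**: on the weighted ball with `60800·ℓ²·R ≤ 1` (B2 under the `Ω`-blocks) and `16ℓR < δ_N` (the (0.4) guard), for an `SU(N)`-valued charted field
`e^{iηA}` the block frame `v(U̿^{(j)}(e^{iηA}))(z)` at every `z ∈ Ω_{j+1}^{(j+1)}` is in `SU(N)` (file 3 `suN_vframeU_dbarIterU` at `s₀ = 2R·L^{−(j+1)}`).
[cite: Balaban1987RG1, (0.9) p.253; Balaban1985Averaging, (110) p.34, Prop. 4 (134)-(135) p.38; Balaban1984PropagatorsII, (2.2) p.224] -/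
theorem suN_vframeU_dbarIterU_of_mem_Om {w : ℕ → PBond P 0 → ℝ} (hw : IsLevWeight P k D w) {R : ℝ} (hR0 : 0 ≤ R)
    (hRflat : 60800 * (((P.d + 2) * P.L : ℕ) : ℝ) ^ 2 * R ≤ 1) (hguard : 16 * (((P.d + 2) * P.L : ℕ) : ℝ) * R < deltaSU (Fin N))
    {A : PBond P 0 → Matrix (Fin N) (Fin N) ℂ} (hA : ∀ b, w 1 b * ‖A b‖ < R)
    (hsu : ∀ b, ∃ s : Matrix.specialUnitaryGroup (Fin N) ℂ, (s : Matrix (Fin N) (Fin N) ℂ) = ((expCfg (((P.L : ℝ)⁻¹) ^ k) A b : (Matrix (Fin N) (Fin N) ℂ)ˣ) : _))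
    (j : ℕ) (z : Site P (j + 1)) (hz : z ∈ D.Om (j + 1)) :
    ∃ s : Matrix.specialUnitaryGroup (Fin N) ℂ, (s : Matrix (Fin N) (Fin N) ℂ) = ((vframeU (dbarIterU j (expCfg (((P.L : ℝ)⁻¹) ^ k) A)) z : (Matrix (Fin N) (Fin N) ℂ)ˣ) : _) := by
  have hL1 : (1 : ℝ) ≤ P.L := by exact_mod_cast P.L_pos
  have hL0 : (0 : ℝ) < P.L := by linarith
  have hℓ1 : (1 : ℝ) ≤ (((P.d + 2) * P.L : ℕ) : ℝ) := by
    exact_mod_cast Nat.one_le_iff_ne_zero.mpr (Nat.mul_ne_zero (by omega) (by have := P.hL.2; omega))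
  -- `j + 1 ≤ k` (else `Ω_{j+1} = ∅`)
  have hj : j + 1 ≤ D.k := by
    by_contra h
    rw [D.Om_eq_empty (not_le.mp h)] at hz
    exact absurd hz (Finset.notMem_empty _)
  have hjP : j + 1 ≤ P.m + P.K := hj.trans D.hk
  have hLj : 0 < (P.L : ℝ) ^ (j + 1) := by positivity
  have hR1 : R ≤ 1 := by nlinarith [mul_nonneg (by positivity : (0:ℝ) ≤ (((P.d + 2) * P.L : ℕ) : ℝ) ^ 2) hR0]
  set s₀ : ℝ := 2 * R * ((P.L : ℝ) ^ (j + 1))⁻¹ with hs₀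
  have hs₀0 : 0 ≤ s₀ := by positivity
  have hkey : (P.L : ℝ) ^ (j + 1) * s₀ = 2 * R := by rw [hs₀]; field_simp
  have hbudget : 8 * 3800 * (((P.d + 2) * P.L : ℕ) : ℝ) ^ 2 * (P.L : ℝ) ^ (j + 1) * s₀ ≤ 1 := by
    calc 8 * 3800 * (((P.d + 2) * P.L : ℕ) : ℝ) ^ 2 * (P.L : ℝ) ^ (j + 1) * s₀
        = 8 * 3800 * (((P.d + 2) * P.L : ℕ) : ℝ) ^ 2 * ((P.L : ℝ) ^ (j + 1) * s₀) := by ring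
      _ = 60800 * (((P.d + 2) * P.L : ℕ) : ℝ) ^ 2 * R := by rw [hkey]; ring
      _ ≤ 1 := hRflat
  have hguard' : 8 * (((P.d + 2) * P.L : ℕ) : ℝ) * (P.L : ℝ) ^ (j + 1) * s₀ ≤ 16 * (((P.d + 2) * P.L : ℕ) : ℝ) * R := by
    calc 8 * (((P.d + 2) * P.L : ℕ) : ℝ) * (P.L : ℝ) ^ (j + 1) * s₀ = 8 * (((P.d + 2) * P.L : ℕ) : ℝ) * ((P.L : ℝ) ^ (j + 1) * s₀) := by ring
      _ = 16 * (((P.d + 2) * P.L : ℕ) : ℝ) * R := by rw [hkey]; ring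
      _ ≤ _ := le_rfl
  refine suN_vframeU_dbarIterU hjP z (expCfg (((P.L : ℝ)⁻¹) ^ k) A) hs₀0 hguard hbudget hguard' (fun b hb _ => ?_) fun b _ _ => hsu b
  exact norm_expCfg_sub_one_le_of_mem_Om k D hDk hw hR1 hA hj hz b hb

end Discharge



/-! ## §4b  The `hidx` hypothesis CLOSED from equal `Q♭`-data on the weighted ball -/

section Hidx

variable [NeZero N] (k : ℕ) (D : Domains P) (hDk : D.k = k)
  (hcollar : ∀ (i : ℕ) (e : PBond P (i + 1)), D.LamBond (i + 1) e → ∀ z : Site P i, (blockOf z = e.src ∨ blockOf z = e.tgt) → z ∈ D.Om i)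

include hDk hcollar in
/-- **THE DOUBLE-BAR BOND VARIABLES OF A CHARTED FIELD AT THE INDICES ARE WITHIN `4LR` OF THE IDENTITY** on the `IsLevWeight` ball with `60800ℓ²LR ≤ 1` (n07-w2
✓`norm_expCfg_sub_one_le_of_weightedBall` on the reading window of the index bond: `s₀ = 2LR·L^{−j}`; UST ✓`norm_dbarIterU_sub_one_le_two_mul₀`). [cite: Balaban1985Averaging, Prop. 4 (134)-(135) p.38; Balaban1985Variational, (150)-(152) p.301, (156) p.302] -/
theorem norm_dbarIterU_expCfg_sub_one_le_of_ball {w : ℕ → PBond P 0 → ℝ} (hw : IsLevWeight P k D w) {R : ℝ} (hR0 : 0 ≤ R)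
    (hRL : 60800 * (((P.d + 2) * P.L : ℕ) : ℝ) ^ 2 * (P.L : ℝ) * R ≤ 1) {A : PBond P 0 → Matrix (Fin N) (Fin N) ℂ} (hA : ∀ b, w 1 b * ‖A b‖ < R) (idx : BondIdx D) :
    ‖((dbarIterU (idx.1.1 : ℕ) (expCfg (((P.L : ℝ)⁻¹) ^ k) A) idx.1.2 : (Matrix (Fin N) (Fin N) ℂ)ˣ) : Matrix (Fin N) (Fin N) ℂ) - 1‖ ≤ 4 * (P.L : ℝ) * R := by
  have hL1 : (1 : ℝ) ≤ P.L := by exact_mod_cast P.L_pos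
  have hL0 : (0 : ℝ) < P.L := by linarith
  have hLj : 0 < (P.L : ℝ) ^ (idx.1.1 : ℕ) := by positivity
  have hR : 12800 * (((P.d + 2) * P.L : ℕ) : ℝ) ^ 2 * (P.L : ℝ) * R ≤ 1 :=
    le_trans (by nlinarith [mul_nonneg (mul_nonneg (by positivity : (0:ℝ) ≤ (((P.d + 2) * P.L : ℕ) : ℝ) ^ 2) hL0.le) hR0]) hRL
  have hjP : (idx.1.1 : ℕ) ≤ P.m + P.K := (Nat.lt_succ_iff.1 idx.1.1.2).trans D.hk
  set s₀ : ℝ := 2 * (P.L : ℝ) * R * ((P.L : ℝ) ^ (idx.1.1 : ℕ))⁻¹ with hs₀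
  have hs₀0 : 0 ≤ s₀ := by positivity
  have hkey : (P.L : ℝ) ^ (idx.1.1 : ℕ) * s₀ = 2 * (P.L : ℝ) * R := by rw [hs₀]; field_simp
  have hbudget : 8 * 3800 * (((P.d + 2) * P.L : ℕ) : ℝ) ^ 2 * (P.L : ℝ) ^ (idx.1.1 : ℕ) * s₀ ≤ 1 := by
    calc 8 * 3800 * (((P.d + 2) * P.L : ℕ) : ℝ) ^ 2 * (P.L : ℝ) ^ (idx.1.1 : ℕ) * s₀
        = 8 * 3800 * (((P.d + 2) * P.L : ℕ) : ℝ) ^ 2 * ((P.L : ℝ) ^ (idx.1.1 : ℕ) * s₀) := by ring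
      _ = 60800 * (((P.d + 2) * P.L : ℕ) : ℝ) ^ 2 * (P.L : ℝ) * R := by rw [hkey]; ring
      _ ≤ 1 := hRL
  have hnear := norm_dbarIterU_sub_one_le_two_mul₀ hjP ({idx.1.2.src, idx.1.2.tgt} : Set (Site P (idx.1.1 : ℕ))) (expCfg (((P.L : ℝ)⁻¹) ^ k) A) hs₀0 hbudget
    (fun b hb _ => by
      refine norm_expCfg_sub_one_le_of_weightedBall k D hDk hcollar hw hR hA idx b ?_
      simpa [Set.mem_insert_iff, Set.mem_singleton_iff] using hb)
    idx.1.2 (by simp) (by simp)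
  calc _ ≤ 2 * ((P.L : ℝ) ^ (idx.1.1 : ℕ) * s₀) := hnear
    _ = 4 * (P.L : ℝ) * R := by rw [hkey]; ring

include hDk hcollar in
/-- ★★ **`hidx` FROM EQUAL `Q♭`-DATA ON THE BALL**: two charted fields in the `IsLevWeight` ball (`60800ℓ²LR ≤ 1`) with `chartLogFlat η D A idx = chartLogFlat η D A₁ idx` have equal
double-bar bond variables at `idx` (companion file §0 with both near-flatness letters discharged: `4LR < 1`) — the (49)♭-charted competitors' `Q♭(chart♭(A′)) = Qlin♭ A′` delivers this.
[cite: Balaban1985Variational, (20) p.281, (44)-(49) p.285, (156) p.302; Balaban1985Averaging, (92) p.31, Prop. 4 (134)-(135) p.38] -/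
theorem dbarIterU_eq_of_chartLogFlat_eq_of_ball {w : ℕ → PBond P 0 → ℝ} (hw : IsLevWeight P k D w) {R : ℝ} (hR0 : 0 ≤ R)
    (hRL : 60800 * (((P.d + 2) * P.L : ℕ) : ℝ) ^ 2 * (P.L : ℝ) * R ≤ 1) {A A₁ : PBond P 0 → Matrix (Fin N) (Fin N) ℂ} (hA : ∀ b, w 1 b * ‖A b‖ < R)
    (hA₁ : ∀ b, w 1 b * ‖A₁ b‖ < R) (idx : BondIdx D) (h : chartLogFlat (((P.L : ℝ)⁻¹) ^ k) D A idx = chartLogFlat (((P.L : ℝ)⁻¹) ^ k) D A₁ idx) :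
    dbarIterU (idx.1.1 : ℕ) (expCfg (((P.L : ℝ)⁻¹) ^ k) A) idx.1.2 = dbarIterU (idx.1.1 : ℕ) (expCfg (((P.L : ℝ)⁻¹) ^ k) A₁) idx.1.2 := by
  have hL1 : (1 : ℝ) ≤ P.L := by exact_mod_cast P.L_pos
  have hℓ1 : (1 : ℝ) ≤ (((P.d + 2) * P.L : ℕ) : ℝ) := by
    exact_mod_cast Nat.one_le_iff_ne_zero.mpr (Nat.mul_ne_zero (by omega) (by have := P.hL.2; omega))
  have h4 : 4 * (P.L : ℝ) * R < 1 := by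
    nlinarith [mul_nonneg (mul_nonneg (by positivity : (0:ℝ) ≤ (((P.d + 2) * P.L : ℕ) : ℝ) ^ 2) (by positivity : (0:ℝ) ≤ (P.L : ℝ))) hR0,
      mul_le_mul_of_nonneg_right (one_le_pow₀ (M₀ := ℝ) hℓ1 : (1:ℝ) ≤ (((P.d + 2) * P.L : ℕ) : ℝ) ^ 2) (by positivity : (0:ℝ) ≤ (P.L : ℝ) * R)]
  exact K0Stub1DoubleBarFibreAtRecord.dbarIterU_eq_of_chartLogFlat_eq (((P.L : ℝ)⁻¹) ^ k) D idx
    ((norm_dbarIterU_expCfg_sub_one_le_of_ball k D hDk hcollar hw hR0 hRL hA idx).trans_lt h4)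
    ((norm_dbarIterU_expCfg_sub_one_le_of_ball k D hDk hcollar hw hR0 hRL hA₁ idx).trans_lt h4) h

end Hidx

/-! ## §5  CLOSED EDITIONS: small-readable blocks := the `Ω`'s, `hvf` discharged — only the ball, the budgets, the charted readings and the equal double-bar data displayed -/

section Closed

variable [NeZero N] (k : ℕ) (D : Domains P) (hDk : D.k = k)
  (hcollar : ∀ (i : ℕ) (e : PBond P (i + 1)), D.LamBond (i + 1) e → ∀ z : Site P i, (blockOf z = e.src ∨ blockOf z = e.tgt) → z ∈ D.Om i)

include hDk hcollar in
/-- ★★★★ **THE ♭ → (0.4) FIBRE DICTIONARY AT THE K0 CARRIER, CLOSED FAMILY FORM.**  `D` nested (`D.k = k`, collar), `IsLevWeight` ball `w₁(b)‖·‖ < R` with the k-UNIFORM budgets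
`12800ℓ²LR ≤ 1`, `60800ℓ²R ≤ 1`, `60ℓ²LR < δ_N`; `SU(N)` fields `U₁`, `U t` reading the charted `e^{iηA₁}`, `e^{iηA t}` (`η = L^{−k}`), all in the ball; EQUAL DOUBLE-BAR DATA on the
(2.3) index bonds; accumulated frames `V₁`, `V t` (any solutions of (97)).  THEN `∃ h : ι → (T_η → SU(N))` with the uniform-choice clause and
`Ū^{(j)}_{(0.4)}((U t)^{h t})(c) = Ū^{(j)}_{(0.4)}(U₁)(c)` at EVERY index bond of EVERY level `j ≤ k` — NO frame∕block hypothesis left (§4 at `Sm := Ω`).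
[cite: Balaban1985Averaging, (11) p.19, (92) p.31, (97)-(100) p.32, (110) p.34, Prop. 4 (134)-(135) p.38; Balaban1984PropagatorsII, (2.1)-(2.4) p.224; Balaban1985Variational, (5)-(6) p.278, (150)-(152) p.301, (156) p.302; Balaban1987RG1, (0.4), (0.9), (0.11) p.253] -/
theorem exists_suGauge_family_iter_eq_closed {w : ℕ → PBond P 0 → ℝ} (hw : IsLevWeight P k D w) {R : ℝ} (hR0 : 0 ≤ R)
    (hR : 12800 * (((P.d + 2) * P.L : ℕ) : ℝ) ^ 2 * (P.L : ℝ) * R ≤ 1) (hRflat : 60800 * (((P.d + 2) * P.L : ℕ) : ℝ) ^ 2 * R ≤ 1)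
    (hguard : 60 * (((P.d + 2) * P.L : ℕ) : ℝ) ^ 2 * (P.L : ℝ) * R < deltaSU (Fin N))
    {ι : Type*} {A₁ : PBond P 0 → Matrix (Fin N) (Fin N) ℂ} {A : ι → PBond P 0 → Matrix (Fin N) (Fin N) ℂ}
    (hA₁ : ∀ b, w 1 b * ‖A₁ b‖ < R) (hA : ∀ t b, w 1 b * ‖A t b‖ < R)
    (U₁ : GaugeField P 0 (Matrix.specialUnitaryGroup (Fin N) ℂ)) (U : ι → GaugeField P 0 (Matrix.specialUnitaryGroup (Fin N) ℂ))
    (hU₁ : ∀ b, ((U₁ b : Matrix.specialUnitaryGroup (Fin N) ℂ) : Matrix (Fin N) (Fin N) ℂ) = ((expCfg (((P.L : ℝ)⁻¹) ^ k) A₁ b : (Matrix (Fin N) (Fin N) ℂ)ˣ) : _))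
    (hU : ∀ t b, ((U t b : Matrix.specialUnitaryGroup (Fin N) ℂ) : Matrix (Fin N) (Fin N) ℂ) = ((expCfg (((P.L : ℝ)⁻¹) ^ k) (A t) b : (Matrix (Fin N) (Fin N) ℂ)ˣ) : _))
    (hidx : ∀ (t : ι) (idx : BondIdx D),
      dbarIterU (idx.1.1 : ℕ) (expCfg (((P.L : ℝ)⁻¹) ^ k) (A t)) idx.1.2 = dbarIterU (idx.1.1 : ℕ) (expCfg (((P.L : ℝ)⁻¹) ^ k) A₁) idx.1.2)
    (V : ι → (j : ℕ) → Site P j → (Matrix (Fin N) (Fin N) ℂ)ˣ) (hV0 : ∀ t x, V t 0 x = 1)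
    (hVs : ∀ (t : ι) (j : ℕ) (y : Site P (j + 1)), V t (j + 1) y = V t j (emb y) * vframeU (dbarIterU j (expCfg (((P.L : ℝ)⁻¹) ^ k) (A t))) y)
    (V₁ : (j : ℕ) → Site P j → (Matrix (Fin N) (Fin N) ℂ)ˣ) (hV₁0 : ∀ x, V₁ 0 x = 1)
    (hV₁s : ∀ (j : ℕ) (y : Site P (j + 1)), V₁ (j + 1) y = V₁ j (emb y) * vframeU (dbarIterU j (expCfg (((P.L : ℝ)⁻¹) ^ k) A₁)) y) :
    ∃ h : ι → GaugeTransf P 0 (Matrix.specialUnitaryGroup (Fin N) ℂ),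
      (∀ x : Site P 0, (∀ t, ((h t x : Matrix.specialUnitaryGroup (Fin N) ℂ) : Matrix (Fin N) (Fin N) ℂ) = 1) ∨
        ∃ (j : ℕ) (c : PBond P j) (y : Site P j), j ≤ D.k ∧ D.LamBond j c ∧ (y = c.src ∨ y = c.tgt) ∧ embIter j y = x ∧
          ∀ t, ((h t x : Matrix.specialUnitaryGroup (Fin N) ℂ) : Matrix (Fin N) (Fin N) ℂ) = ((V₁ j y * (V t j y)⁻¹ : (Matrix (Fin N) (Fin N) ℂ)ˣ) : _)) ∧
      ∀ (t : ι) (j : ℕ) (c : PBond P j), j ≤ k → D.LamBond j c →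
        Averaging.iter (fun _ => blockAvg expMeanLogSU) j (GaugeField.gaugeAct (h t) (U t)) c = Averaging.iter (fun _ => blockAvg expMeanLogSU) j U₁ c := by
  have hL1 : (1 : ℝ) ≤ P.L := by exact_mod_cast P.L_pos
  have hℓ1 : (1 : ℝ) ≤ (((P.d + 2) * P.L : ℕ) : ℝ) := by
    exact_mod_cast Nat.one_le_iff_ne_zero.mpr (Nat.mul_ne_zero (by omega) (by have := P.hL.2; omega))
  -- the (0.4) guard under the `Ω`-blocks: `16ℓR ≤ 60ℓ²LR < δ_N`
  have hguard16 : 16 * (((P.d + 2) * P.L : ℕ) : ℝ) * R < deltaSU (Fin N) := by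
    refine lt_of_le_of_lt ?_ hguard
    have h0 : 0 ≤ (((P.d + 2) * P.L : ℕ) : ℝ) * R := by positivity
    nlinarith [mul_le_mul (mul_le_mul hℓ1 hL1 (by norm_num) (by positivity)) le_rfl h0 (by positivity)]
  refine exists_suGauge_family_iter_eq k D hDk hcollar hw hR hguard hA₁ hA U₁ U hU₁ hU hidx V hV0 hVs V₁ hV₁0 hV₁s
    (fun j => {y : Site P j | y ∈ D.Om j}) (fun j z hz => ?_) (fun j y _ hy => hy) (fun j z hz => ?_) (fun t j z hz => ?_)
  · -- `emb`-closed: `blockOf (emb z) = z ∈ Ω_{j+1}` ⇒ `emb z ∈ Ω_j`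
    have hj : j + 1 ≤ D.k := by
      by_contra h
      have hz' : z ∈ D.Om (j + 1) := hz
      rw [D.Om_eq_empty (not_le.mp h)] at hz'
      exact absurd hz' (Finset.notMem_empty _)
    exact D.nested (emb z) (by rw [Site.blockOf_emb (hj.trans D.hk)]; exact hz)
  · exact suN_vframeU_dbarIterU_of_mem_Om k D hDk hw hR0 hRflat hguard16 hA₁ (fun b => ⟨U₁ b, hU₁ b⟩) j z hz
  · exact suN_vframeU_dbarIterU_of_mem_Om k D hDk hw hR0 hRflat hguard16 (hA t) (fun b => ⟨U t b, hU t b⟩) j z hz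

include hDk hcollar in
/-- ★★★★ **CLOSED, ONE COMPETITOR, NO FRAMES DISPLAYED**: ball + budgets + charted `SU(N)` readings + equal double-bar data on the index bonds ⇒ `∃ h : T_η → SU(N)`,
`Ū^{(j)}_{(0.4)}(U^{h})(c) = Ū^{(j)}_{(0.4)}(U₁)(c)` at every index bond of every level `j ≤ k` — the competitor has an `SU(N)` gauge copy in NODE 00's multi-level (0.4) fibre through `U₁`.
[cite: Balaban1985Averaging, (11) p.19, (92) p.31, (97)-(100) p.32; Balaban1984PropagatorsII, (2.1)-(2.4) p.224; Balaban1985Variational, (5)-(6) p.278, (152) p.301, (156) p.302; Balaban1987RG1, (0.4), (0.11) p.253] -/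
theorem exists_suGauge_iter_eq_closed {w : ℕ → PBond P 0 → ℝ} (hw : IsLevWeight P k D w) {R : ℝ} (hR0 : 0 ≤ R)
    (hR : 12800 * (((P.d + 2) * P.L : ℕ) : ℝ) ^ 2 * (P.L : ℝ) * R ≤ 1) (hRflat : 60800 * (((P.d + 2) * P.L : ℕ) : ℝ) ^ 2 * R ≤ 1)
    (hguard : 60 * (((P.d + 2) * P.L : ℕ) : ℝ) ^ 2 * (P.L : ℝ) * R < deltaSU (Fin N))
    {A₁ A : PBond P 0 → Matrix (Fin N) (Fin N) ℂ} (hA₁ : ∀ b, w 1 b * ‖A₁ b‖ < R) (hA : ∀ b, w 1 b * ‖A b‖ < R)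
    (U₁ U : GaugeField P 0 (Matrix.specialUnitaryGroup (Fin N) ℂ))
    (hU₁ : ∀ b, ((U₁ b : Matrix.specialUnitaryGroup (Fin N) ℂ) : Matrix (Fin N) (Fin N) ℂ) = ((expCfg (((P.L : ℝ)⁻¹) ^ k) A₁ b : (Matrix (Fin N) (Fin N) ℂ)ˣ) : _))
    (hU : ∀ b, ((U b : Matrix.specialUnitaryGroup (Fin N) ℂ) : Matrix (Fin N) (Fin N) ℂ) = ((expCfg (((P.L : ℝ)⁻¹) ^ k) A b : (Matrix (Fin N) (Fin N) ℂ)ˣ) : _))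
    (hidx : ∀ idx : BondIdx D, dbarIterU (idx.1.1 : ℕ) (expCfg (((P.L : ℝ)⁻¹) ^ k) A) idx.1.2 = dbarIterU (idx.1.1 : ℕ) (expCfg (((P.L : ℝ)⁻¹) ^ k) A₁) idx.1.2) :
    ∃ h : GaugeTransf P 0 (Matrix.specialUnitaryGroup (Fin N) ℂ), ∀ (j : ℕ) (c : PBond P j), j ≤ k → D.LamBond j c →
      Averaging.iter (fun _ => blockAvg expMeanLogSU) j (GaugeField.gaugeAct h U) c = Averaging.iter (fun _ => blockAvg expMeanLogSU) j U₁ c := by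
  obtain ⟨V, hV0, hVs, -⟩ := exists_accFrames_dbarIterU (P := P) (expCfg (((P.L : ℝ)⁻¹) ^ k) A)
  obtain ⟨V₁, hV₁0, hV₁s, -⟩ := exists_accFrames_dbarIterU (P := P) (expCfg (((P.L : ℝ)⁻¹) ^ k) A₁)
  obtain ⟨h, -, hh⟩ := exists_suGauge_family_iter_eq_closed k D hDk hcollar hw hR0 hR hRflat hguard (A := fun _ : Unit => A) hA₁ (fun _ => hA) U₁ (fun _ => U)
    hU₁ (fun _ => hU) (fun _ => hidx) (fun _ => V) (fun _ => hV0) (fun _ => hVs) V₁ hV₁0 hV₁s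
  exact ⟨h (), hh ()⟩

end Closed

/-! ## §6  NODE 00 edition, closed: `avgFamily (avOfRecord F N K)` -/

section T4Closed

open T4Continuum (T4Family)

variable (F : T4Family) (N : ℕ) [NeZero N] (K k : ℕ) (D : Domains (F.P K)) (hDk : D.k = k)
  (hcollar : ∀ (i : ℕ) (e : PBond (F.P K) (i + 1)), D.LamBond (i + 1) e → ∀ z : Site (F.P K) i, (blockOf z = e.src ∨ blockOf z = e.tgt) → z ∈ D.Om i)

include hDk hcollar in
/-- ★★★★ **NODE 00 EDITION, CLOSED FAMILY FORM** — the curve-ready statement for the ♭-road socket: for the charted base point `U₁ = e^{iηA₁}` and every family of charted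
competitors `U t = e^{iηA t}` with the double-bar data of the base point (ball + budgets as above), `∃ h : ι → (T_η → SU(N))` with the uniform-choice clause and
`avgFamily (avOfRecord F N K) ((U t)^{h t}) j c = avgFamily (avOfRecord F N K) U₁ j c` at every (2.3) index bond of every level `j ≤ k` — the letters of `Node00.IsCritOnFibre` ∕ `AgreeOn`.
[cite: Balaban1985Variational, (5)-(6) p.278, (156) p.302; Balaban1988Convergent, (2.10)-(2.12) p.256; Balaban1985Averaging, (92) p.31, (97)-(100) p.32; Balaban1987RG1, (0.4), (0.11) p.253] -/
theorem exists_suGauge_family_avgFamily_eq_closed {w : ℕ → PBond (F.P K) 0 → ℝ} (hw : IsLevWeight (F.P K) k D w) {R : ℝ} (hR0 : 0 ≤ R)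
    (hR : 12800 * ((((F.P K).d + 2) * (F.P K).L : ℕ) : ℝ) ^ 2 * ((F.P K).L : ℝ) * R ≤ 1) (hRflat : 60800 * ((((F.P K).d + 2) * (F.P K).L : ℕ) : ℝ) ^ 2 * R ≤ 1)
    (hguard : 60 * ((((F.P K).d + 2) * (F.P K).L : ℕ) : ℝ) ^ 2 * ((F.P K).L : ℝ) * R < deltaSU (Fin N))
    {ι : Type*} {A₁ : PBond (F.P K) 0 → Matrix (Fin N) (Fin N) ℂ} {A : ι → PBond (F.P K) 0 → Matrix (Fin N) (Fin N) ℂ}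
    (hA₁ : ∀ b, w 1 b * ‖A₁ b‖ < R) (hA : ∀ t b, w 1 b * ‖A t b‖ < R)
    (U₁ : GaugeField (F.P K) 0 (Matrix.specialUnitaryGroup (Fin N) ℂ)) (U : ι → GaugeField (F.P K) 0 (Matrix.specialUnitaryGroup (Fin N) ℂ))
    (hU₁ : ∀ b, ((U₁ b : Matrix.specialUnitaryGroup (Fin N) ℂ) : Matrix (Fin N) (Fin N) ℂ) = ((expCfg ((((F.P K).L : ℝ)⁻¹) ^ k) A₁ b : (Matrix (Fin N) (Fin N) ℂ)ˣ) : _))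
    (hU : ∀ t b, ((U t b : Matrix.specialUnitaryGroup (Fin N) ℂ) : Matrix (Fin N) (Fin N) ℂ) = ((expCfg ((((F.P K).L : ℝ)⁻¹) ^ k) (A t) b : (Matrix (Fin N) (Fin N) ℂ)ˣ) : _))
    (hidx : ∀ (t : ι) (idx : BondIdx D),
      dbarIterU (idx.1.1 : ℕ) (expCfg ((((F.P K).L : ℝ)⁻¹) ^ k) (A t)) idx.1.2 = dbarIterU (idx.1.1 : ℕ) (expCfg ((((F.P K).L : ℝ)⁻¹) ^ k) A₁) idx.1.2)
    (V : ι → (j : ℕ) → Site (F.P K) j → (Matrix (Fin N) (Fin N) ℂ)ˣ) (hV0 : ∀ t x, V t 0 x = 1)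
    (hVs : ∀ (t : ι) (j : ℕ) (y : Site (F.P K) (j + 1)), V t (j + 1) y = V t j (emb y) * vframeU (dbarIterU j (expCfg ((((F.P K).L : ℝ)⁻¹) ^ k) (A t))) y)
    (V₁ : (j : ℕ) → Site (F.P K) j → (Matrix (Fin N) (Fin N) ℂ)ˣ) (hV₁0 : ∀ x, V₁ 0 x = 1)
    (hV₁s : ∀ (j : ℕ) (y : Site (F.P K) (j + 1)), V₁ (j + 1) y = V₁ j (emb y) * vframeU (dbarIterU j (expCfg ((((F.P K).L : ℝ)⁻¹) ^ k) A₁)) y) :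
    ∃ h : ι → GaugeTransf (F.P K) 0 (Matrix.specialUnitaryGroup (Fin N) ℂ),
      (∀ x : Site (F.P K) 0, (∀ t, ((h t x : Matrix.specialUnitaryGroup (Fin N) ℂ) : Matrix (Fin N) (Fin N) ℂ) = 1) ∨
        ∃ (j : ℕ) (c : PBond (F.P K) j) (y : Site (F.P K) j), j ≤ D.k ∧ D.LamBond j c ∧ (y = c.src ∨ y = c.tgt) ∧ embIter j y = x ∧
          ∀ t, ((h t x : Matrix.specialUnitaryGroup (Fin N) ℂ) : Matrix (Fin N) (Fin N) ℂ) = ((V₁ j y * (V t j y)⁻¹ : (Matrix (Fin N) (Fin N) ℂ)ˣ) : _)) ∧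
      ∀ (t : ι) (j : ℕ) (c : PBond (F.P K) j), j ≤ k → D.LamBond j c →
        avgFamily (avOfRecord F N K) (GaugeField.gaugeAct (h t) (U t)) j c = avgFamily (avOfRecord F N K) U₁ j c :=
  exists_suGauge_family_iter_eq_closed k D hDk hcollar hw hR0 hR hRflat hguard hA₁ hA U₁ U hU₁ hU hidx V hV0 hVs V₁ hV₁0 hV₁s

end T4Closed

end Summit.QuantumFields.YangMills.Theorems.K0Stub1DoubleBarFibreAtRecordClosed

end
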